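import Mathlib.Data.Real.Basic
import Mathlib.Algebra.Order.Chebyshev
import Mathlib.Tactic
import Literature.Probability.LatticeModels.LatticeGraph
import Summits.QuantumFields.YangMills.Theorems.BalabanUVNodesN07PointFeasibilityEnergyIdentity
import Summits.QuantumFields.YangMills.Theorems.BalabanUVNodesN07PointFeasibilityIMS
import HarnessLib

/-!
# DAG node N07 — THE DISCRETE PLATE (SECOND-ORDER) CACCIOPPOLI INEQUALITY WITH CUT-OFF on the torus,
# forcing term kept: road item (L2), first brick, of the localisation road to the multi-level point-feasibility lemma (P)_D

Width seat `pub-ymgap-dag-n07-w7` (g6), count-neutral helper (`--supports … --as helper`); companion of this lineage's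
`…Theorems.BalabanUVNodesN07PointFeasibilityEnergyIdentity` (g3: the calculus `fd`, `bd`, `lap` on `TorusSite d N`,
summation by parts) and `…Theorems.BalabanUVNodesN07PointFeasibilityIMS` (g3: discrete Leibniz `lap_mul`, `fd_mul`, the
IMS identities = road item (L3)).

THE ROAD (dag-n07-w5 g0′ LOCATED-PD-LOCALIZATION-ROAD §2–§3; g2 LOCATED-L2-DISCRETE-CACCIOPPOLI §0–§1).  The plate energy
`‖Δw‖²` of a solution of `Δ²w = f` is localised with cut-offs `χ` supported on transition layers; what the assembly (L4)
needs from (L2) is an INTERIOR estimate at two orders for the discrete bilaplacian, with the FORCING PAIRING KEPT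
(n07-w5 g2 §1: «the forcing term `⟨f, η²(w − w̄)⟩` stays; (L2)+(L4) is a two-estimate package»).  This file types that
inequality on the torus, for an ARBITRARY cut-off `χ` and an ARBITRARY function `u` (nothing is assumed on `Δ²u`):
* §1 first order (needed by §2, in the calculus of the (P)_D files; symmetric bond weight):
  `two_mul_fd_sq_mul` (`2∂ᵢ(χ²u) = (χ²+χ′²)∂ᵢu + (χ′²−χ²)(u+u′)`), the pointwise SOS `caccioppoli_pointwise`,
  ★ `caccioppoli_lap` (`ΣᵢΣ_x (χ(x)²+χ(x+eᵢ)²)(∂ᵢu x)² ≤ −4Σ_x χ²u·Δu + 2ΣᵢΣ_x (∂ᵢχ x)²(u x+u(x+eᵢ))²`),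
  `caccioppoli_lap_of_lap_eq_zero`, ★ `dirichlet_interpolation` (the layer gradient by the plate energy and `u²`:
  `… ≤ 2t·Σχ²(Δu)² + (2∕t)·Σχ²u² + 4Σ(∂χ)²(u²+u′²)`, any `t > 0`).
* §2 ★★ THE PLATE: `lap_sq_mul` (`Δ(χ²u) = χ²Δu + 2χ·K_χu + G_χu` with g3's transport letters
  `K_χu(x) = Σᵢ[(χ(x+eᵢ)−χ(x))u(x+eᵢ) + (χ(x−eᵢ)−χ(x))u(x−eᵢ)]`, `G_χu(x) = Σᵢ[(χ(x+eᵢ)−χ(x))²u(x+eᵢ) + (χ(x−eᵢ)−χ(x))²u(x−eᵢ)]`),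
  `sum_sq_mul_mul_lap_lap` (`Σχ²u·Δ²u = ΣΔ(χ²u)·Δu`), ★ `plate_identity`
  (`Σχ²(Δu)² = Σχ²u·Δ²u − 2Σχ·Δu·K_χu − ΣΔu·G_χu`, exact), ★★ `plate_caccioppoli_core`
  (`Σχ²(Δu)² ≤ 2Σχ²u·Δ²u + 4Σ(K_χu)² − 2ΣΔu·G_χu`), `transport_sq_le` (`(K_χu)² ≤ 2d·Σᵢ[(∂ᵢχ)²u(x+eᵢ)² + (∂ᵢ⁻χ)²u(x−eᵢ)²]`),
  `sum_lap_mul_weight_shift` (the `G`-term by parts: only `u`, `∂u` survive, with weights `(∂χ)²` and `∂((∂χ)²)`),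
  ★★★ `plate_caccioppoli` — **Caccioppoli at two orders for the discrete bilaplacian, forcing kept**:
  `Σχ²(Δu)² ≤ 2Σχ²u·Δ²u + 8d·W₀ + W₁ + T` with `W₀ = Σ(∂χ)²·u²`, `W₁ = Σ(∂χ)²·(∂u)²`, `T = Σ|∂((∂χ)²)|·|u|·|∂u|`
  (every error term is supported where `χ` varies; with `|∂χ| ≤ R⁻¹` and `|∂((∂χ)²)| ≤ 2R⁻³` the consumer gets the
  scale-correct `R⁻²Σ_layer|∇u|² + R⁻⁴Σ_layer u²` after one Young split of `T`).
The FIRST-order lattice Caccioppoli inequality is in the tree twice on other carriers —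
`Literature.….B4Eq19LatticeCaccioppoli.caccioppoli` (boxes of `ℤᵈ`, massive `lop κ`, cell pub-balaban NE9) and
`Literature.….B9Ineq346SecondOrderTorusCore.caccioppoli_torus` (matrix torus `boxDom N`, `perLapT`, seat dag-n06-h) — and is
NOT claimed new here: §1 is its `TorusSite`∕`lap` edition with the symmetric weight that §2 consumes.  The second-order
(plate) inequality §2 is the new content.

HONEST SCOPE.  Finite-difference algebra and Young's inequality on one torus; asserts NOTHING about [B11]∕[B6]∕[3]; the
interior-regularity half of (L2) (oscillation of discrete biharmonic functions on a cube) and the assembly (L4) are NOT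
here; (P)_D for Bałaban's `d = 4` geometries OPEN; `hker` at the record, stub 1, K0⁷ ∕ K1⁹ NOT closed; N07 not
discharged; nothing continuum ∕ OS ∕ mass gap.  Context only (no hypothesis is a citation): the Caccioppoli
inequality, M. Giaquinta, *Multiple integrals in the calculus of variations and nonlinear elliptic systems* (1983)
Ch. III §2 [Giaquinta1984]; T. Bałaban, CMP **96** (1984) 223–250 [Balaban1984PropagatorsII] (1.9), (2.22).
-/

set_option autoImplicit false

noncomputable section

open Finset

namespace Summit.QuantumFields.YangMills.Theorems.N07PlateCaccioppoli

open Literature.Probability.LatticeModels (TorusSite)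
open Summit.QuantumFields.YangMills.Theorems.N07PointFeasibilityEnergyIdentity (fd bd lap sum_shift sum_shift_sub
  sum_mul_lap sum_mul_lap_comm sum_fd_mul sum_mul_fd bd_eq_fd_sub)
open Summit.QuantumFields.YangMills.Theorems.N07PointFeasibilityIMS (lap_mul fd_mul)

variable {d N : ℕ}

/-! ## §1  First order: the cut-off Caccioppoli inequality for `lap` with the symmetric bond weight -/

section FirstOrderRing

variable {𝕜 : Type*} [CommRing 𝕜]

/-- The symmetric Leibniz split of a weighted difference:
`2·∂ᵢ(χ²u)(x) = (χ(x)² + χ(x+eᵢ)²)·∂ᵢu(x) + (χ(x+eᵢ)² − χ(x)²)·(u(x) + u(x+eᵢ))`. [folklore] -/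
theorem two_mul_fd_sq_mul (i : Fin d) (χ u : TorusSite d N → 𝕜) (x : TorusSite d N) :
    2 * fd i (fun y => χ y ^ 2 * u y) x =
      (χ x ^ 2 + χ (x + Pi.single i 1) ^ 2) * fd i u x +
        (χ (x + Pi.single i 1) ^ 2 - χ x ^ 2) * (u x + u (x + Pi.single i 1)) := by
  simp only [fd]; ring

variable [NeZero N]

/-- Testing `Δu` against `χ²u`: `Σ_x χ(x)²u(x)·Δu(x) = −Σᵢ Σ_x ∂ᵢ(χ²u)(x)·∂ᵢu(x)`. [folklore] -/
theorem sum_sq_mul_mul_lap (χ u : TorusSite d N → 𝕜) :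
    ∑ x, χ x ^ 2 * u x * lap u x = -∑ i, ∑ x, fd i (fun y => χ y ^ 2 * u y) x * fd i u x :=
  sum_mul_lap (fun y => χ y ^ 2 * u y) u

/-- The tested form written with the symmetric split:
`−2Σ_x χ²u·Δu = Σᵢ Σ_x [(χ²+χ′²)(∂ᵢu)² + (χ′²−χ²)(u+u′)∂ᵢu]`. [folklore] -/
theorem neg_two_mul_sum_sq_mul_mul_lap (χ u : TorusSite d N → 𝕜) :
    -2 * ∑ x, χ x ^ 2 * u x * lap u x =
      ∑ i, ∑ x, ((χ x ^ 2 + χ (x + Pi.single i 1) ^ 2) * fd i u x ^ 2 +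
        (χ (x + Pi.single i 1) ^ 2 - χ x ^ 2) * (u x + u (x + Pi.single i 1)) * fd i u x) := by
  rw [sum_sq_mul_mul_lap, mul_neg, neg_mul, neg_neg, Finset.mul_sum]
  refine Finset.sum_congr rfl (fun i _ => ?_)
  rw [Finset.mul_sum]
  refine Finset.sum_congr rfl (fun x _ => ?_)
  have h := two_mul_fd_sq_mul i χ u x
  calc 2 * (fd i (fun y => χ y ^ 2 * u y) x * fd i u x)
      = (2 * fd i (fun y => χ y ^ 2 * u y) x) * fd i u x := by ring
    _ = _ := by rw [h]; ring

end FirstOrderRing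

section FirstOrderReal

/-- ★ **The pointwise sum of squares behind Caccioppoli.**  With `S = a² + b²`, `D = b² − a²`, `γ = b − a`,
`δ = q − p`, `U = p + q`:  `S δ² + 2 D U δ + 2 γ² U² = ½((a+b)δ + 2γU)² + ½(a−b)²δ² ≥ 0`. [folklore] -/
theorem caccioppoli_pointwise (a b p q : ℝ) :
    0 ≤ (a ^ 2 + b ^ 2) * (q - p) ^ 2 + 2 * ((b ^ 2 - a ^ 2) * (p + q) * (q - p)) +
      2 * ((b - a) ^ 2 * (p + q) ^ 2) := by
  nlinarith [sq_nonneg ((a + b) * (q - p) + 2 * (b - a) * (p + q)), sq_nonneg ((a - b) * (q - p))]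

variable [NeZero N]

/-- ★ **CACCIOPPOLI INEQUALITY WITH CUT-OFF for the torus Laplacian** (symmetric bond weight, any `χ`, any `u`):
`Σᵢ Σ_x (χ(x)² + χ(x+eᵢ)²)·(∂ᵢu(x))² ≤ −4·Σ_x χ(x)²u(x)Δu(x) + 2·Σᵢ Σ_x (∂ᵢχ(x))²·(u(x) + u(x+eᵢ))²`.
(Test `Δu` against `χ²u`, split symmetrically, absorb by `caccioppoli_pointwise`.)  The tree's first-order neighbours on
other carriers: `B4Eq19LatticeCaccioppoli.caccioppoli` (`ℤᵈ` boxes), `B9Ineq346SecondOrderTorusCore.caccioppoli_torus`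
(matrix torus). [folklore] -/
theorem caccioppoli_lap (χ u : TorusSite d N → ℝ) :
    ∑ i, ∑ x, (χ x ^ 2 + χ (x + Pi.single i 1) ^ 2) * fd i u x ^ 2 ≤
      -4 * ∑ x, χ x ^ 2 * u x * lap u x +
        2 * ∑ i, ∑ x, fd i χ x ^ 2 * (u x + u (x + Pi.single i 1)) ^ 2 := by
  have h2 := neg_two_mul_sum_sq_mul_mul_lap χ u
  -- the summed pointwise SOS
  have hsos : 0 ≤ ∑ i, ∑ x, ((χ x ^ 2 + χ (x + Pi.single i 1) ^ 2) * fd i u x ^ 2 +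
      2 * ((χ (x + Pi.single i 1) ^ 2 - χ x ^ 2) * (u x + u (x + Pi.single i 1)) * fd i u x) +
      2 * ((χ (x + Pi.single i 1) - χ x) ^ 2 * (u x + u (x + Pi.single i 1)) ^ 2)) :=
    Finset.sum_nonneg (fun i _ => Finset.sum_nonneg (fun x _ => by
      have := caccioppoli_pointwise (χ x) (χ (x + Pi.single i 1)) (u x) (u (x + Pi.single i 1))
      simpa only [fd] using this))
  have e1 : ∑ i, ∑ x, ((χ x ^ 2 + χ (x + Pi.single i 1) ^ 2) * fd i u x ^ 2 +
      2 * ((χ (x + Pi.single i 1) ^ 2 - χ x ^ 2) * (u x + u (x + Pi.single i 1)) * fd i u x) +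
      2 * ((χ (x + Pi.single i 1) - χ x) ^ 2 * (u x + u (x + Pi.single i 1)) ^ 2)) =
      2 * (∑ i, ∑ x, ((χ x ^ 2 + χ (x + Pi.single i 1) ^ 2) * fd i u x ^ 2 +
        (χ (x + Pi.single i 1) ^ 2 - χ x ^ 2) * (u x + u (x + Pi.single i 1)) * fd i u x)) -
      ∑ i, ∑ x, (χ x ^ 2 + χ (x + Pi.single i 1) ^ 2) * fd i u x ^ 2 +
      2 * ∑ i, ∑ x, fd i χ x ^ 2 * (u x + u (x + Pi.single i 1)) ^ 2 := by
    simp only [fd, Finset.mul_sum, ← Finset.sum_sub_distrib, ← Finset.sum_add_distrib]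
    refine Finset.sum_congr rfl (fun i _ => Finset.sum_congr rfl (fun x _ => by ring))
  rw [e1, ← h2] at hsos
  linarith

/-- Caccioppoli for a function harmonic where the cut-off lives: if `Δu(x) = 0` whenever `χ(x) ≠ 0`, then
`Σᵢ Σ_x (χ(x)² + χ(x+eᵢ)²)(∂ᵢu(x))² ≤ 2·Σᵢ Σ_x (∂ᵢχ(x))²(u(x) + u(x+eᵢ))²`. [folklore] -/
theorem caccioppoli_lap_of_lap_eq_zero (χ u : TorusSite d N → ℝ) (h : ∀ x, χ x ≠ 0 → lap u x = 0) :
    ∑ i, ∑ x, (χ x ^ 2 + χ (x + Pi.single i 1) ^ 2) * fd i u x ^ 2 ≤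
      2 * ∑ i, ∑ x, fd i χ x ^ 2 * (u x + u (x + Pi.single i 1)) ^ 2 := by
  have h0 : ∑ x, χ x ^ 2 * u x * lap u x = 0 := by
    refine Finset.sum_eq_zero (fun x _ => ?_)
    by_cases hx : χ x = 0
    · simp [hx]
    · simp [h x hx]
  have := caccioppoli_lap χ u
  rw [h0, mul_zero, zero_add] at this
  exact this

/-- ★ **Interpolation: the cut-off gradient by the plate energy and the mass.**  For any `t > 0`,
`Σᵢ Σ_x (χ(x)² + χ(x+eᵢ)²)(∂ᵢu(x))² ≤ 2t·Σ_x χ(x)²(Δu(x))² + (2∕t)·Σ_x χ(x)²u(x)² + 2·Σᵢ Σ_x (∂ᵢχ(x))²(u(x)+u(x+eᵢ))²`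
(Young on `−4χ²uΔu ≤ 2tχ²(Δu)² + (2∕t)χ²u²`). [folklore] -/
theorem dirichlet_interpolation (χ u : TorusSite d N → ℝ) {t : ℝ} (ht : 0 < t) :
    ∑ i, ∑ x, (χ x ^ 2 + χ (x + Pi.single i 1) ^ 2) * fd i u x ^ 2 ≤
      2 * t * ∑ x, χ x ^ 2 * lap u x ^ 2 + 2 / t * ∑ x, χ x ^ 2 * u x ^ 2 +
        2 * ∑ i, ∑ x, fd i χ x ^ 2 * (u x + u (x + Pi.single i 1)) ^ 2 := by
  have hc := caccioppoli_lap χ u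
  have hy : -4 * ∑ x, χ x ^ 2 * u x * lap u x ≤
      2 * t * ∑ x, χ x ^ 2 * lap u x ^ 2 + 2 / t * ∑ x, χ x ^ 2 * u x ^ 2 := by
    rw [Finset.mul_sum, Finset.mul_sum, Finset.mul_sum, ← Finset.sum_add_distrib]
    refine Finset.sum_le_sum (fun x _ => ?_)
    -- pointwise Young: −4ab ≤ 2t b² + (2/t) a²  with a = χu, b = χΔu
    have ht' : 0 < 2 / t := by positivity
    have key : 0 ≤ t * (χ x * lap u x + (1 / t) * (χ x * u x)) ^ 2 := by positivity
    have e : t * (χ x * lap u x + (1 / t) * (χ x * u x)) ^ 2 =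
        t * (χ x ^ 2 * lap u x ^ 2) + 2 * (χ x ^ 2 * u x * lap u x) + (1 / t) * (χ x ^ 2 * u x ^ 2) := by
      field_simp
      ring
    rw [e] at key
    have e2 : 2 / t * (χ x ^ 2 * u x ^ 2) = 2 * ((1 / t) * (χ x ^ 2 * u x ^ 2)) := by ring
    rw [e2]
    nlinarith [key]
  linarith

end FirstOrderReal

/-! ## §2  Second order: the plate Caccioppoli inequality (discrete bilaplacian, forcing term kept) -/

section PlateRing

variable {𝕜 : Type*} [CommRing 𝕜]

/-- ★ **Leibniz for `Δ` against a squared cut-off, in transport letters**: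
`Δ(χ²u)(x) = χ(x)²Δu(x) + 2χ(x)·K_χu(x) + G_χu(x)` with
`K_χu(x) = Σᵢ [(χ(x+eᵢ)−χ(x))u(x+eᵢ) + (χ(x−eᵢ)−χ(x))u(x−eᵢ)]` and
`G_χu(x) = Σᵢ [(χ(x+eᵢ)−χ(x))²u(x+eᵢ) + (χ(x−eᵢ)−χ(x))²u(x−eᵢ)]` (g3's `lap_mul` with `χ'² − χ² = 2χ(χ'−χ) + (χ'−χ)²`).
[folklore] -/
theorem lap_sq_mul (χ u : TorusSite d N → 𝕜) (x : TorusSite d N) :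
    lap (fun y => χ y ^ 2 * u y) x = χ x ^ 2 * lap u x +
      2 * χ x * ∑ i, ((χ (x + Pi.single i 1) - χ x) * u (x + Pi.single i 1) +
        (χ (x - Pi.single i 1) - χ x) * u (x - Pi.single i 1)) +
      ∑ i, ((χ (x + Pi.single i 1) - χ x) ^ 2 * u (x + Pi.single i 1) +
        (χ (x - Pi.single i 1) - χ x) ^ 2 * u (x - Pi.single i 1)) := by
  have h : lap (fun y => χ y ^ 2 * u y) x = χ x ^ 2 * lap u x +
      ∑ i, ((χ (x + Pi.single i 1) ^ 2 - χ x ^ 2) * u (x + Pi.single i 1) +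
        (χ (x - Pi.single i 1) ^ 2 - χ x ^ 2) * u (x - Pi.single i 1)) := lap_mul (fun y => χ y ^ 2) u x
  rw [h, add_assoc, Finset.mul_sum, ← Finset.sum_add_distrib]
  congr 1
  exact Finset.sum_congr rfl (fun i _ => by ring)

variable [NeZero N]

/-- Testing `Δ²u` against `χ²u` moves one Laplacian: `Σ_x χ(x)²u(x)·Δ²u(x) = Σ_x Δ(χ²u)(x)·Δu(x)`. [folklore] -/
theorem sum_sq_mul_mul_lap_lap (χ u : TorusSite d N → 𝕜) :
    ∑ x, χ x ^ 2 * u x * lap (lap u) x = ∑ x, lap (fun y => χ y ^ 2 * u y) x * lap u x :=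
  sum_mul_lap_comm (fun y => χ y ^ 2 * u y) (lap u)

/-- ★ **The plate identity** (exact): `Σ_x χ²(Δu)² = Σ_x χ²u·Δ²u − 2Σ_x χ·Δu·K_χu − Σ_x Δu·G_χu`. [folklore] -/
theorem plate_identity (χ u : TorusSite d N → 𝕜) :
    ∑ x, χ x ^ 2 * lap u x ^ 2 = ∑ x, χ x ^ 2 * u x * lap (lap u) x -
      2 * ∑ x, χ x * lap u x * ∑ i, ((χ (x + Pi.single i 1) - χ x) * u (x + Pi.single i 1) +
        (χ (x - Pi.single i 1) - χ x) * u (x - Pi.single i 1)) -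
      ∑ x, lap u x * ∑ i, ((χ (x + Pi.single i 1) - χ x) ^ 2 * u (x + Pi.single i 1) +
        (χ (x - Pi.single i 1) - χ x) ^ 2 * u (x - Pi.single i 1)) := by
  rw [sum_sq_mul_mul_lap_lap, Finset.mul_sum, ← Finset.sum_sub_distrib, ← Finset.sum_sub_distrib]
  refine Finset.sum_congr rfl (fun x _ => ?_)
  rw [lap_sq_mul]
  ring

/-- **The weight term by parts.**  For any weight `ρ` and any `v`,
`Σ_x Δu(x)·(ρ(x)v(x)) = −Σⱼ Σ_x (ρ(x+eⱼ)·∂ⱼv(x) + ∂ⱼρ(x)·v(x))·∂ⱼu(x)` — only first differences of `u`, `v` and of the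
weight survive. [folklore] -/
theorem sum_lap_mul_mul (ρ v u : TorusSite d N → 𝕜) :
    ∑ x, lap u x * (ρ x * v x) =
      -∑ j, ∑ x, (ρ (x + Pi.single j 1) * fd j v x + fd j ρ x * v x) * fd j u x := by
  have h : ∑ x, lap u x * (ρ x * v x) = ∑ x, (ρ x * v x) * lap u x :=
    Finset.sum_congr rfl (fun x _ => mul_comm _ _)
  rw [h, sum_mul_lap]
  congr 1
  refine Finset.sum_congr rfl (fun j _ => Finset.sum_congr rfl (fun x _ => ?_))
  rw [fd_mul]

end PlateRing

section PlateReal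

/-- The transport term is a sum of `2d` products: `(K_χu(x))² ≤ 2d·Σᵢ [(∂ᵢχ(x))²u(x+eᵢ)² + (∂ᵢ⁻χ(x))²u(x−eᵢ)²]`
(Cauchy–Schwarz). [folklore] -/
theorem transport_sq_le (χ u : TorusSite d N → ℝ) (x : TorusSite d N) :
    (∑ i, ((χ (x + Pi.single i 1) - χ x) * u (x + Pi.single i 1) +
        (χ (x - Pi.single i 1) - χ x) * u (x - Pi.single i 1))) ^ 2 ≤
      2 * d * ∑ i, (fd i χ x ^ 2 * u (x + Pi.single i 1) ^ 2 + bd i χ x ^ 2 * u (x - Pi.single i 1) ^ 2) := by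
  have h1 := sq_sum_le_card_mul_sum_sq (s := (Finset.univ : Finset (Fin d)))
    (f := fun i => (χ (x + Pi.single i 1) - χ x) * u (x + Pi.single i 1) +
        (χ (x - Pi.single i 1) - χ x) * u (x - Pi.single i 1))
  simp only [Finset.card_univ, Fintype.card_fin] at h1
  have h2 : ∀ i : Fin d, ((χ (x + Pi.single i 1) - χ x) * u (x + Pi.single i 1) +
        (χ (x - Pi.single i 1) - χ x) * u (x - Pi.single i 1)) ^ 2 ≤
      2 * (fd i χ x ^ 2 * u (x + Pi.single i 1) ^ 2 + bd i χ x ^ 2 * u (x - Pi.single i 1) ^ 2) := by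
    intro i
    have e1 : (χ (x + Pi.single i 1) - χ x) = fd i χ x := rfl
    have e2 : (χ (x - Pi.single i 1) - χ x) = -bd i χ x := by simp only [bd]; ring
    rw [e1, e2]
    nlinarith [sq_nonneg (fd i χ x * u (x + Pi.single i 1) + bd i χ x * u (x - Pi.single i 1))]
  have h3 : (d : ℝ) * ∑ i, ((χ (x + Pi.single i 1) - χ x) * u (x + Pi.single i 1) +
        (χ (x - Pi.single i 1) - χ x) * u (x - Pi.single i 1)) ^ 2 ≤
      (d : ℝ) * ∑ i, 2 * (fd i χ x ^ 2 * u (x + Pi.single i 1) ^ 2 + bd i χ x ^ 2 * u (x - Pi.single i 1) ^ 2) :=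
    mul_le_mul_of_nonneg_left (Finset.sum_le_sum (fun i _ => h2 i)) (Nat.cast_nonneg d)
  rw [← Finset.mul_sum] at h3
  linarith

variable [NeZero N]

/-- ★★ **Plate Caccioppoli, core form**: `Σ_x χ²(Δu)² ≤ 2Σ_x χ²u·Δ²u + 4Σ_x (K_χu)² − 2Σ_x Δu·G_χu`
(the identity `plate_identity` and Young `−2χΔu·K ≤ ½χ²(Δu)² + 2K²`). [folklore] -/
theorem plate_caccioppoli_core (χ u : TorusSite d N → ℝ) :
    ∑ x, χ x ^ 2 * lap u x ^ 2 ≤ 2 * ∑ x, χ x ^ 2 * u x * lap (lap u) x +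
      4 * ∑ x, (∑ i, ((χ (x + Pi.single i 1) - χ x) * u (x + Pi.single i 1) +
        (χ (x - Pi.single i 1) - χ x) * u (x - Pi.single i 1))) ^ 2 -
      2 * ∑ x, lap u x * ∑ i, ((χ (x + Pi.single i 1) - χ x) ^ 2 * u (x + Pi.single i 1) +
        (χ (x - Pi.single i 1) - χ x) ^ 2 * u (x - Pi.single i 1)) := by
  have hid := plate_identity χ u
  -- Young, summed
  have hy : -(2 * ∑ x, χ x * lap u x * ∑ i, ((χ (x + Pi.single i 1) - χ x) * u (x + Pi.single i 1) +
        (χ (x - Pi.single i 1) - χ x) * u (x - Pi.single i 1))) ≤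
      (1 / 2) * ∑ x, χ x ^ 2 * lap u x ^ 2 +
      2 * ∑ x, (∑ i, ((χ (x + Pi.single i 1) - χ x) * u (x + Pi.single i 1) +
        (χ (x - Pi.single i 1) - χ x) * u (x - Pi.single i 1))) ^ 2 := by
    rw [Finset.mul_sum, Finset.mul_sum, Finset.mul_sum, ← Finset.sum_neg_distrib, ← Finset.sum_add_distrib]
    refine Finset.sum_le_sum (fun x _ => ?_)
    nlinarith [sq_nonneg (χ x * lap u x + 2 * ∑ i, ((χ (x + Pi.single i 1) - χ x) * u (x + Pi.single i 1) +
        (χ (x - Pi.single i 1) - χ x) * u (x - Pi.single i 1)))]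
  linarith

/-- **The weight term, bounded**: for a non-negative weight `ρ` and any `v`,
`−Σ_x Δu(x)·(ρ(x)v(x)) ≤ Σⱼ Σ_x [ρ(x+eⱼ)·((∂ⱼv(x))² + (∂ⱼu(x))²)∕2 + |∂ⱼρ(x)|·|v(x)|·|∂ⱼu(x)|]`
(`sum_lap_mul_mul` and Young on the first product; the trilinear term is left to the consumer's scale-aware split).
[folklore] -/
theorem neg_sum_lap_mul_mul_le (ρ v u : TorusSite d N → ℝ) (hρ : ∀ x, 0 ≤ ρ x) :
    -∑ x, lap u x * (ρ x * v x) ≤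
      ∑ j, ∑ x, (ρ (x + Pi.single j 1) * ((fd j v x) ^ 2 + (fd j u x) ^ 2) / 2 +
        |fd j ρ x| * |v x| * |fd j u x|) := by
  rw [sum_lap_mul_mul, neg_neg]
  refine Finset.sum_le_sum (fun j _ => Finset.sum_le_sum (fun x _ => ?_))
  have hρ' := hρ (x + Pi.single j 1)
  have t1 : ρ (x + Pi.single j 1) * fd j v x * fd j u x ≤
      ρ (x + Pi.single j 1) * ((fd j v x) ^ 2 + (fd j u x) ^ 2) / 2 := by
    nlinarith [mul_nonneg hρ' (sq_nonneg (fd j v x - fd j u x))]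
  have t2 : fd j ρ x * v x * fd j u x ≤ |fd j ρ x| * |v x| * |fd j u x| := by
    rw [← abs_mul, ← abs_mul]; exact le_abs_self _
  nlinarith [t1, t2]

/-- ★★★ **THE PLATE CACCIOPPOLI INEQUALITY — Caccioppoli at two orders for the discrete bilaplacian, forcing kept.**
For every cut-off `χ` and every `u` on the torus,
`Σ_x χ²(Δu)² ≤ 2Σ_x χ²u·Δ²u + 8d·Σ_xΣᵢ[(∂ᵢχ)²u(x+eᵢ)² + (∂ᵢ⁻χ)²u(x−eᵢ)²]`
`  + 2ΣᵢΣⱼΣ_x [ (∂ᵢχ(x+eⱼ))²((∂ⱼu(x+eᵢ))² + (∂ⱼu(x))²)∕2 + |∂ⱼ(∂ᵢχ)²(x)|·|u(x+eᵢ)|·|∂ⱼu(x)|`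
`               + (∂ᵢ⁻χ(x+eⱼ))²((∂ⱼu(x−eᵢ))² + (∂ⱼu(x))²)∕2 + |∂ⱼ(∂ᵢ⁻χ)²(x)|·|u(x−eᵢ)|·|∂ⱼu(x)| ]`:
the localised plate energy is bounded by the forcing pairing plus terms in `u` and `∂u` ONLY, each weighted by a
square or a difference of squares of first differences of the cut-off, hence supported where `χ` varies.  With
`|∂χ| ≤ R⁻¹`, `|∂(∂χ)²| ≤ 2R⁻³` and the split `|u||∂u| ≤ (R⁻¹u² + R(∂u)²)∕2` every error is `R⁻²Σ_layer(∂u)² + R⁻⁴Σ_layer u²`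
— the displayed (L2) shape, forcing kept. [folklore] -/
theorem plate_caccioppoli (χ u : TorusSite d N → ℝ) :
    ∑ x, χ x ^ 2 * lap u x ^ 2 ≤ 2 * ∑ x, χ x ^ 2 * u x * lap (lap u) x +
      8 * d * ∑ x, ∑ i, (fd i χ x ^ 2 * u (x + Pi.single i 1) ^ 2 + bd i χ x ^ 2 * u (x - Pi.single i 1) ^ 2) +
      2 * ∑ i, ∑ j, ∑ x,
        ((fd i χ (x + Pi.single j 1) ^ 2 * ((fd j u (x + Pi.single i 1)) ^ 2 + (fd j u x) ^ 2) / 2 +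
            |fd j (fun y => fd i χ y ^ 2) x| * |u (x + Pi.single i 1)| * |fd j u x|) +
          (bd i χ (x + Pi.single j 1) ^ 2 * ((fd j u (x - Pi.single i 1)) ^ 2 + (fd j u x) ^ 2) / 2 +
            |fd j (fun y => bd i χ y ^ 2) x| * |u (x - Pi.single i 1)| * |fd j u x|)) := by
  have hcore := plate_caccioppoli_core χ u
  -- the transport square
  have hK : 4 * ∑ x, (∑ i, ((χ (x + Pi.single i 1) - χ x) * u (x + Pi.single i 1) +
        (χ (x - Pi.single i 1) - χ x) * u (x - Pi.single i 1))) ^ 2 ≤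
      8 * d * ∑ x, ∑ i, (fd i χ x ^ 2 * u (x + Pi.single i 1) ^ 2 + bd i χ x ^ 2 * u (x - Pi.single i 1) ^ 2) := by
    have : ∑ x, (∑ i, ((χ (x + Pi.single i 1) - χ x) * u (x + Pi.single i 1) +
        (χ (x - Pi.single i 1) - χ x) * u (x - Pi.single i 1))) ^ 2 ≤
        ∑ x, 2 * d * ∑ i, (fd i χ x ^ 2 * u (x + Pi.single i 1) ^ 2 + bd i χ x ^ 2 * u (x - Pi.single i 1) ^ 2) :=
      Finset.sum_le_sum (fun x _ => transport_sq_le χ u x)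
    rw [← Finset.mul_sum] at this
    linarith
  -- the weight term: split `Σ_x Δu·G_χu` into the `2d` pairings `Σ_x Δu·(ρ v)`
  have e : ∑ x, lap u x * ∑ i, ((χ (x + Pi.single i 1) - χ x) ^ 2 * u (x + Pi.single i 1) +
        (χ (x - Pi.single i 1) - χ x) ^ 2 * u (x - Pi.single i 1)) =
      ∑ i, (∑ x, lap u x * (fd i χ x ^ 2 * u (x + Pi.single i 1)) +
        ∑ x, lap u x * (bd i χ x ^ 2 * u (x - Pi.single i 1))) := by
    have pt : ∀ x, lap u x * ∑ i, ((χ (x + Pi.single i 1) - χ x) ^ 2 * u (x + Pi.single i 1) +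
        (χ (x - Pi.single i 1) - χ x) ^ 2 * u (x - Pi.single i 1)) =
        ∑ i, (lap u x * (fd i χ x ^ 2 * u (x + Pi.single i 1)) + lap u x * (bd i χ x ^ 2 * u (x - Pi.single i 1))) := by
      intro x
      rw [Finset.mul_sum]
      refine Finset.sum_congr rfl (fun i _ => ?_)
      simp only [fd, bd]; ring
    rw [Finset.sum_congr rfl (fun x _ => pt x), Finset.sum_comm]
    exact Finset.sum_congr rfl (fun i _ => Finset.sum_add_distrib)
  -- shifted differences `∂ⱼ(u(·±eᵢ))(x) = ∂ⱼu(x±eᵢ)`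
  have sp : ∀ (i j : Fin d) (x : TorusSite d N),
      fd j (fun y => u (y + Pi.single i 1)) x = fd j u (x + Pi.single i 1) := by
    intro i j x; simp only [fd, add_right_comm x (Pi.single j 1) (Pi.single i 1)]
  have sm : ∀ (i j : Fin d) (x : TorusSite d N),
      fd j (fun y => u (y - Pi.single i 1)) x = fd j u (x - Pi.single i 1) := by
    intro i j x; simp only [fd, sub_add_eq_add_sub]
  have step : ∀ i : Fin d,
      -(∑ x, lap u x * (fd i χ x ^ 2 * u (x + Pi.single i 1)) +
        ∑ x, lap u x * (bd i χ x ^ 2 * u (x - Pi.single i 1))) ≤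
      ∑ j, ∑ x,
        ((fd i χ (x + Pi.single j 1) ^ 2 * ((fd j u (x + Pi.single i 1)) ^ 2 + (fd j u x) ^ 2) / 2 +
            |fd j (fun y => fd i χ y ^ 2) x| * |u (x + Pi.single i 1)| * |fd j u x|) +
          (bd i χ (x + Pi.single j 1) ^ 2 * ((fd j u (x - Pi.single i 1)) ^ 2 + (fd j u x) ^ 2) / 2 +
            |fd j (fun y => bd i χ y ^ 2) x| * |u (x - Pi.single i 1)| * |fd j u x|)) := by
    intro i
    have hp := neg_sum_lap_mul_mul_le (fun y => fd i χ y ^ 2) (fun y => u (y + Pi.single i 1)) u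
      (fun y => sq_nonneg _)
    have hm := neg_sum_lap_mul_mul_le (fun y => bd i χ y ^ 2) (fun y => u (y - Pi.single i 1)) u
      (fun y => sq_nonneg _)
    beta_reduce at hp hm
    simp only [sp, sm] at hp hm
    have hsplit : ∑ j, ∑ x,
        ((fd i χ (x + Pi.single j 1) ^ 2 * ((fd j u (x + Pi.single i 1)) ^ 2 + (fd j u x) ^ 2) / 2 +
            |fd j (fun y => fd i χ y ^ 2) x| * |u (x + Pi.single i 1)| * |fd j u x|) +
          (bd i χ (x + Pi.single j 1) ^ 2 * ((fd j u (x - Pi.single i 1)) ^ 2 + (fd j u x) ^ 2) / 2 +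
            |fd j (fun y => bd i χ y ^ 2) x| * |u (x - Pi.single i 1)| * |fd j u x|)) =
        ∑ j, ∑ x, (fd i χ (x + Pi.single j 1) ^ 2 * ((fd j u (x + Pi.single i 1)) ^ 2 + (fd j u x) ^ 2) / 2 +
            |fd j (fun y => fd i χ y ^ 2) x| * |u (x + Pi.single i 1)| * |fd j u x|) +
        ∑ j, ∑ x, (bd i χ (x + Pi.single j 1) ^ 2 * ((fd j u (x - Pi.single i 1)) ^ 2 + (fd j u x) ^ 2) / 2 +
            |fd j (fun y => bd i χ y ^ 2) x| * |u (x - Pi.single i 1)| * |fd j u x|) := by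
      rw [← Finset.sum_add_distrib]
      exact Finset.sum_congr rfl (fun j _ => Finset.sum_add_distrib)
    rw [hsplit]
    linarith
  have hG := Finset.sum_le_sum (fun i (_ : i ∈ (Finset.univ : Finset (Fin d))) => step i)
  rw [Finset.sum_neg_distrib, ← e] at hG
  linarith

end PlateReal


end Summit.QuantumFields.YangMills.Theorems.N07PlateCaccioppoli

end
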